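import Summits.AtomisticToContinuum.Crystallization.Theses.GappedShellCensus
import Literature.Geometry.DiscreteGeometry.KissingFanTriangleSets
import Literature.Geometry.DiscreteGeometry.SphericalCodeHullVertexLink
import Summits.AtomisticToContinuum.Crystallization.Theorems.GappedShellCensusShellTrichotomyStubOriginInterior
import Summits.AtomisticToContinuum.Crystallization.Theorems.GappedShellCensusShellTrichotomyStubBondHullEdge
import Summits.AtomisticToContinuum.Crystallization.Theorems.GappedShellCensusShellTrichotomyStubBondTriangleFacet

/-!
# Crux `GappedShellCensus.ShellTrichotomy` (stmt-AtomisticToContinuum-18070), line `Sketch` —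
# stub `stub_fanStruct`

The structural half of the dictionary GEOMETRY → labelled fan data of the census half of the
crux.  For an all-degree-four gapped twelve-shell `t : Fin 12 → ℝ³` (norms in `[0.98, 1.02]`,
pairwise distances `≥ 0.98` and either `≤ 1.02` — a bond — or `≥ 1.26`, every point with exactly
four bonded shell neighbours) let `u k = t k / ‖t k‖`, `X = {u k}` (the radially normalised
shell) and let `tri` be the set of label sets `S ⊆ Fin 12` with `S.image u ∈ fanTriSets X`, the
fan-refined hull triangulation of `X` pulled back along the labelling.  Then: every triple of
`tri` has three labels; `tri` has twenty triples; every side of a triple lies in exactly two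
triples; every bond is a side of exactly two triples; every bonded triangle is a triple; and the
link of every label is connected in the closure sense of `fanTriSets_link`.

## Proof

Pure transport along the bijection `S ↦ S.image u` between label sets and subsets of `X` — the
labelling `u` is injective because two distinct shell directions have cosine `≤ 2801/5202 < 1`
(`inner_normalize_le`) — applied to the tree's `card_eq_three_of_mem_fanTriSets`,
`card_fanTriSets`, `card_filter_fanTriSets_eq_two`,
`card_filter_fanTriSets_eq_two_of_mem_hullEdges` and `fanTriSets_link`.  Their geometric inputs
are the landed stubs: `stub_originInterior` (`0 ∈ interior (conv X)`), `stub_bondHullEdge`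
(a bond `{u v, u w}` is a hull edge: `⟪u v, u w⟫ ≥ 2201/4802` by `le_inner_normalize`, while
`⟪u v, y⟫ + ⟪u w, y⟫ ≤ 2 · 2801/5202 < 1 + 2201/4802` for every other `y ∈ X`), and
`stub_bondTriangleFacet` (a bonded triangle `{u a, u b, u c}` is exactly the tight set of a facet
normal `c₀`, hence — three tight points — the vertex set of the fan triangle `(c₀, 0)`).
-/

noncomputable section

namespace Summit.AtomisticToContinuum.Crystallization.Theorems

open Literature.Geometry.DiscreteGeometry
open scoped RealInnerProductSpace

/-! ### The dictionary: cosines between shell directions -/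

/-- The cosine of the angle between two shell directions, in terms of the points. -/
private theorem inner_normalize (a c : EuclideanSpace ℝ (Fin 3)) (ha : 0 < ‖a‖)
    (hc : 0 < ‖c‖) :
    ⟪‖a‖⁻¹ • a, ‖c‖⁻¹ • c⟫ = ⟪a, c⟫ / (‖a‖ * ‖c‖) := by
  -- adapted from `GappedShellCensusShellTrichotomyStubOriginInterior` (private there)
  rw [real_inner_smul_left, real_inner_smul_right]
  field_simp

/-- Two shell points at distance `≥ 0.98` subtend an angle with cosine `≤ 2801/5202` (the value
for radii `1.02, 1.02` and distance `0.98`). -/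
private theorem inner_normalize_le {a c : EuclideanSpace ℝ (Fin 3)}
    (ha : 1 - 1 / 50 ≤ ‖a‖ ∧ ‖a‖ ≤ 1 + 1 / 50) (hc : 1 - 1 / 50 ≤ ‖c‖ ∧ ‖c‖ ≤ 1 + 1 / 50)
    (hd : 1 - 1 / 50 ≤ dist a c) : ⟪‖a‖⁻¹ • a, ‖c‖⁻¹ • c⟫ ≤ 2801 / 5202 := by
  have ha0 : 0 < ‖a‖ := by linarith [ha.1]
  have hc0 : 0 < ‖c‖ := by linarith [hc.1]
  rw [inner_normalize a c ha0 hc0, div_le_iff₀ (mul_pos ha0 hc0)]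
  have h := norm_sub_sq_real a c
  rw [← dist_eq_norm] at h
  have hd2 : (1 - 1 / 50 : ℝ) ^ 2 ≤ dist a c ^ 2 := pow_le_pow_left₀ (by norm_num) hd 2
  nlinarith [mul_nonneg (sub_nonneg.2 ha.1) (sub_nonneg.2 ha.2),
    mul_nonneg (sub_nonneg.2 hc.1) (sub_nonneg.2 hc.2),
    mul_nonneg (sub_nonneg.2 ha.2) (sub_nonneg.2 hc.2)]

/-- Two BONDED shell points (distance `≤ 1.02`) subtend an angle with cosine `≥ 2201/4802` (the
value for radii `0.98, 0.98` and distance `1.02`). -/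
private theorem le_inner_normalize {a c : EuclideanSpace ℝ (Fin 3)}
    (ha : 1 - 1 / 50 ≤ ‖a‖ ∧ ‖a‖ ≤ 1 + 1 / 50) (hc : 1 - 1 / 50 ≤ ‖c‖ ∧ ‖c‖ ≤ 1 + 1 / 50)
    (hd : dist a c ≤ 1 + 1 / 50) : 2201 / 4802 ≤ ⟪‖a‖⁻¹ • a, ‖c‖⁻¹ • c⟫ := by
  have ha0 : 0 < ‖a‖ := by linarith [ha.1]
  have hc0 : 0 < ‖c‖ := by linarith [hc.1]
  rw [inner_normalize a c ha0 hc0, le_div_iff₀ (mul_pos ha0 hc0)]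
  have h := norm_sub_sq_real a c
  rw [← dist_eq_norm] at h
  have hd2 : dist a c ^ 2 ≤ (1 + 1 / 50 : ℝ) ^ 2 := pow_le_pow_left₀ dist_nonneg hd 2
  nlinarith [mul_nonneg (sub_nonneg.2 ha.1) (sub_nonneg.2 hc.1), sq_nonneg (‖a‖ - ‖c‖)]

/-- **Shared facts about the normalised shell**: unit norms, the two cosine bounds, and
injectivity of the labelling `k ↦ t k / ‖t k‖`. -/
private theorem shell_facts (t : Fin 12 → EuclideanSpace ℝ (Fin 3))
    (hn : ∀ k, 1 - 1 / 50 ≤ ‖t k‖ ∧ ‖t k‖ ≤ 1 + 1 / 50)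
    (hd : ∀ k l, k ≠ l → 1 - 1 / 50 ≤ dist (t k) (t l) ∧
      (dist (t k) (t l) ≤ 1 + 1 / 50 ∨ 63 / 50 ≤ dist (t k) (t l))) :
    (∀ k, ‖‖t k‖⁻¹ • t k‖ = 1) ∧
    (∀ k l, k ≠ l → ⟪‖t k‖⁻¹ • t k, ‖t l‖⁻¹ • t l⟫ ≤ 2801 / 5202) ∧
    (∀ k l, dist (t k) (t l) ≤ 1 + 1 / 50 → 2201 / 4802 ≤ ⟪‖t k‖⁻¹ • t k, ‖t l‖⁻¹ • t l⟫) ∧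
    Function.Injective (fun k => ‖t k‖⁻¹ • t k) := by
  have hu1 : ∀ k, ‖‖t k‖⁻¹ • t k‖ = 1 := fun k => by
    have hk : 0 < ‖t k‖ := by linarith [(hn k).1]
    rw [norm_smul, norm_inv, norm_norm, inv_mul_cancel₀ hk.ne']
  have hhi : ∀ k l, k ≠ l → ⟪‖t k‖⁻¹ • t k, ‖t l‖⁻¹ • t l⟫ ≤ 2801 / 5202 := fun k l hkl =>
    inner_normalize_le (hn k) (hn l) (hd k l hkl).1
  refine ⟨hu1, hhi, fun k l hkl => le_inner_normalize (hn k) (hn l) hkl, fun k l hkl => ?_⟩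
  by_contra hne
  have h := hhi k l hne
  have hkl' : ‖t k‖⁻¹ • t k = ‖t l‖⁻¹ • t l := hkl
  rw [hkl', real_inner_self_eq_norm_sq, hu1 l] at h
  norm_num at h

/-! ### Transport along the labelling -/

section Transport

variable {u : Fin 12 → EuclideanSpace ℝ (Fin 3)} {X : Finset (EuclideanSpace ℝ (Fin 3))}
  {tri : Finset (Finset (Fin 12))}

/-- The labelled points are points of `X`. -/
private theorem apply_mem (hX : X = Finset.univ.image u) (k : Fin 12) : u k ∈ X := by
  rw [hX]
  exact Finset.mem_image_of_mem u (Finset.mem_univ k)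

/-- `X` consists of unit vectors. -/
private theorem norm_eq_one_of_mem (hu1 : ∀ k, ‖u k‖ = 1) (hX : X = Finset.univ.image u) :
    ∀ y ∈ X, ‖y‖ = 1 := by
  subst hX
  intro y hy
  obtain ⟨k, -, rfl⟩ := Finset.mem_image.1 hy
  exact hu1 k

/-- Distinct points of `X` have inner product `≤ 2801/5202`. -/
private theorem inner_le_of_mem (hhi : ∀ k l, k ≠ l → ⟪u k, u l⟫ ≤ 2801 / 5202)
    (hX : X = Finset.univ.image u) : ∀ y ∈ X, ∀ y' ∈ X, y ≠ y' → ⟪y, y'⟫ ≤ 2801 / 5202 := by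
  subst hX
  intro y hy y' hy' hne
  obtain ⟨k, -, rfl⟩ := Finset.mem_image.1 hy
  obtain ⟨l, -, rfl⟩ := Finset.mem_image.1 hy'
  exact hhi k l fun h => hne (congrArg u h)

/-- A fan triangle of `X` is the image of a label triple of `tri`. -/
private theorem exists_image_eq_of_mem (hX1 : ∀ y ∈ X, ‖y‖ = 1) (hX : X = Finset.univ.image u)
    (htri : ∀ S, S ∈ tri ↔ S.image u ∈ fanTriSets X) {T : Finset (EuclideanSpace ℝ (Fin 3))}
    (hT : T ∈ fanTriSets X) : ∃ S ∈ tri, S.image u = T := by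
  have hTX : T ⊆ Finset.univ.image u := hX ▸ subset_of_mem_fanTriSets hX1 hT
  obtain ⟨S, rfl⟩ := Finset.subset_univ_image_iff.1 hTX
  exact ⟨S, (htri S).2 hT, rfl⟩

/-- `S ↦ S.image u` maps `tri` onto `fanTriSets X`. -/
private theorem image_tri (hX1 : ∀ y ∈ X, ‖y‖ = 1) (hX : X = Finset.univ.image u)
    (htri : ∀ S, S ∈ tri ↔ S.image u ∈ fanTriSets X) :
    tri.image (Finset.image u) = fanTriSets X := by
  ext T
  rw [Finset.mem_image]
  constructor
  · rintro ⟨S, hS, rfl⟩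
    exact (htri S).1 hS
  · intro hT
    obtain ⟨S, hS, rfl⟩ := exists_image_eq_of_mem hX1 hX htri hT
    exact ⟨S, hS, rfl⟩

/-- Counting the triples through a label set `s` is counting the fan triangles through
`s.image u`. -/
private theorem card_filter_tri (hu : Function.Injective u) (hX1 : ∀ y ∈ X, ‖y‖ = 1)
    (hX : X = Finset.univ.image u) (htri : ∀ S, S ∈ tri ↔ S.image u ∈ fanTriSets X)
    (s : Finset (Fin 12)) :
    (tri.filter fun S' => s ⊆ S').card =
      ((fanTriSets X).filter fun T => s.image u ⊆ T).card := by
  rw [← Finset.card_image_of_injective (tri.filter fun S' => s ⊆ S') (Finset.image_injective hu)]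
  congr 1
  ext T
  simp only [Finset.mem_image, Finset.mem_filter]
  constructor
  · rintro ⟨S, ⟨hS, hsS⟩, rfl⟩
    exact ⟨(htri S).1 hS, Finset.image_subset_image hsS⟩
  · rintro ⟨hT, hsT⟩
    obtain ⟨S, hS, rfl⟩ := exists_image_eq_of_mem hX1 hX htri hT
    exact ⟨S, ⟨hS, (Finset.image_subset_image_iff hu).1 hsT⟩, rfl⟩

/-- Field 1: every triple has three labels. -/
private theorem card_eq_three_of_mem_tri (hu : Function.Injective u) (hX1 : ∀ y ∈ X, ‖y‖ = 1)
    (htri : ∀ S, S ∈ tri ↔ S.image u ∈ fanTriSets X) : ∀ S ∈ tri, S.card = 3 := by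
  intro S hS
  rw [← Finset.card_image_of_injective S hu]
  exact card_eq_three_of_mem_fanTriSets hX1 ((htri S).1 hS)

/-- Field 2: twenty triples. -/
private theorem card_tri (hu : Function.Injective u) (hX1 : ∀ y ∈ X, ‖y‖ = 1)
    (hX : X = Finset.univ.image u) (htri : ∀ S, S ∈ tri ↔ S.image u ∈ fanTriSets X)
    (h0 : (0 : EuclideanSpace ℝ (Fin 3)) ∈
      interior (convexHull ℝ (X : Set (EuclideanSpace ℝ (Fin 3))))) :
    tri.card = 20 := by
  have h12 : X.card = 12 := by
    rw [hX, Finset.card_image_of_injective _ hu, Finset.card_univ, Fintype.card_fin]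
  rw [← Finset.card_image_of_injective tri (Finset.image_injective hu), image_tri hX1 hX htri]
  exact card_fanTriSets h12 hX1 h0

/-- Field 3: every side of a triple lies in exactly two triples. -/
private theorem card_filter_side (hu : Function.Injective u) (hX1 : ∀ y ∈ X, ‖y‖ = 1)
    (hX : X = Finset.univ.image u) (htri : ∀ S, S ∈ tri ↔ S.image u ∈ fanTriSets X)
    (h0 : (0 : EuclideanSpace ℝ (Fin 3)) ∈
      interior (convexHull ℝ (X : Set (EuclideanSpace ℝ (Fin 3))))) :
    ∀ S ∈ tri, ∀ s ⊆ S, s.card = 2 → (tri.filter fun S' => s ⊆ S').card = 2 := by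
  intro S hS s hs h2
  rw [card_filter_tri hu hX1 hX htri s]
  exact card_filter_fanTriSets_eq_two hX1 h0 ((htri S).1 hS) (Finset.image_subset_image hs)
    (by rw [Finset.card_image_of_injective s hu, h2])

/-- Field 4: a bond (cosine `≥ 2201/4802`) is a side of exactly two triples
(`stub_bondHullEdge`). -/
private theorem card_filter_bond (hu : Function.Injective u) (hX1 : ∀ y ∈ X, ‖y‖ = 1)
    (hX : X = Finset.univ.image u) (htri : ∀ S, S ∈ tri ↔ S.image u ∈ fanTriSets X)
    (h0 : (0 : EuclideanSpace ℝ (Fin 3)) ∈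
      interior (convexHull ℝ (X : Set (EuclideanSpace ℝ (Fin 3)))))
    (hhi : ∀ k l, k ≠ l → ⟪u k, u l⟫ ≤ 2801 / 5202) {v w : Fin 12} (hvw : v ≠ w)
    (hb : 2201 / 4802 ≤ ⟪u v, u w⟫) :
    (tri.filter fun S' => ({v, w} : Finset (Fin 12)) ⊆ S').card = 2 := by
  rw [card_filter_tri hu hX1 hX htri, Finset.image_insert, Finset.image_singleton]
  refine card_filter_fanTriSets_eq_two_of_mem_hullEdges hX1 h0
    (stub_bondHullEdge X hX1 (u v) (u w) (apply_mem hX v) (apply_mem hX w) (hu.ne hvw)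
      (by linarith) ?_)
  intro y hy hyv hyw
  rw [hX] at hy
  obtain ⟨m, -, rfl⟩ := Finset.mem_image.1 hy
  have h1 := hhi v m fun h => hyv (congrArg u h).symm
  have h2 := hhi w m fun h => hyw (congrArg u h).symm
  linarith

/-- Field 5: a bonded triangle is a triple (`stub_bondTriangleFacet`: it is exactly the tight
set of a facet, hence the vertex set of the fan triangle `(c₀, 0)` of that facet). -/
private theorem triple_mem_tri (hu : Function.Injective u) (hX1 : ∀ y ∈ X, ‖y‖ = 1)
    (hX : X = Finset.univ.image u) (htri : ∀ S, S ∈ tri ↔ S.image u ∈ fanTriSets X)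
    (hhi : ∀ k l, k ≠ l → ⟪u k, u l⟫ ≤ 2801 / 5202) {a b c : Fin 12} (hab : a ≠ b)
    (hbc : b ≠ c) (hac : a ≠ c) (kab : 2201 / 4802 ≤ ⟪u a, u b⟫)
    (kbc : 2201 / 4802 ≤ ⟪u b, u c⟫) (kac : 2201 / 4802 ≤ ⟪u a, u c⟫) :
    ({a, b, c} : Finset (Fin 12)) ∈ tri := by
  obtain ⟨c₀, hc₀, htight⟩ := stub_bondTriangleFacet X hX1 (inner_le_of_mem hhi hX) (u a) (u b)
    (u c) (apply_mem hX a) (apply_mem hX b) (apply_mem hX c) (hu.ne hab) (hu.ne hbc) (hu.ne hac)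
    kab kbc kac
  have himg : ({a, b, c} : Finset (Fin 12)).image u = {u a, u b, u c} := by
    rw [Finset.image_insert, Finset.image_insert, Finset.image_singleton]
  have h3 : (tightSet X c₀).card = 3 := by
    rw [htight, ← himg, Finset.card_image_of_injective _ hu]
    exact Finset.card_eq_three.2 ⟨a, b, c, hab, hac, hbc, rfl⟩
  have hp : (c₀, 0) ∈ fanTriangles X :=
    mem_fanTriangles.2 ⟨hc₀, by change 0 + 2 < (tightSet X c₀).card; omega⟩
  have heq : fanVerts X (c₀, 0) = tightSet X c₀ :=
    Finset.eq_of_subset_of_card_le (fanVerts_subset_tightSet hX1 hp)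
      (h3.trans (fanVerts_card hX1 hp).symm).le
  rw [htri, himg, ← htight]
  exact mem_fanTriSets.2 ⟨(c₀, 0), hp, heq⟩

/-- Field 6: the link of a label is connected (closure form), from `fanTriSets_link`. -/
private theorem link_tri (hu : Function.Injective u) (hX1 : ∀ y ∈ X, ‖y‖ = 1)
    (hX : X = Finset.univ.image u) (htri : ∀ S, S ∈ tri ↔ S.image u ∈ fanTriSets X)
    (h0 : (0 : EuclideanSpace ℝ (Fin 3)) ∈
      interior (convexHull ℝ (X : Set (EuclideanSpace ℝ (Fin 3)))))
    (v : Fin 12) (A : Finset (Finset (Fin 12))) (hA : A ⊆ tri.filter fun S => v ∈ S)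
    (hne : A.Nonempty)
    (hcl : ∀ S ∈ A, ∀ S' ∈ tri, v ∈ S' → (S ∩ S').card = 2 → S' ∈ A) :
    A = tri.filter fun S => v ∈ S := by
  have key : A.image (Finset.image u) = (fanTriSets X).filter fun T => u v ∈ T := by
    refine fanTriSets_link hX1 h0 ?_ (hne.image _) ?_
    · intro T hT
      obtain ⟨S, hS, rfl⟩ := Finset.mem_image.1 hT
      obtain ⟨hS1, hS2⟩ := Finset.mem_filter.1 (hA hS)
      exact Finset.mem_filter.2 ⟨(htri S).1 hS1, hu.mem_finset_image.2 hS2⟩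
    · intro T hT T' hT' hvT' h2
      obtain ⟨S, hS, rfl⟩ := Finset.mem_image.1 hT
      obtain ⟨S', hS', rfl⟩ := exists_image_eq_of_mem hX1 hX htri hT'
      rw [← Finset.image_inter _ _ hu, Finset.card_image_of_injective _ hu] at h2
      exact Finset.mem_image_of_mem _ (hcl S hS S' hS' (hu.mem_finset_image.1 hvT') h2)
  refine Finset.Subset.antisymm hA fun S hS => ?_
  obtain ⟨hS1, hS2⟩ := Finset.mem_filter.1 hS
  have hSA : S.image u ∈ A.image (Finset.image u) := by
    rw [key]
    exact Finset.mem_filter.2 ⟨(htri S).1 hS1, hu.mem_finset_image.2 hS2⟩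
  obtain ⟨S₀, hS₀, he⟩ := Finset.mem_image.1 hSA
  exact Finset.image_injective hu he ▸ hS₀

end Transport

/-! ### The stub -/

/-- **Dictionary, structural part (geometry → labelled fan triangulation).** For an all-degree-4
gapped twelve-tuple `t`, the fan triangles `fanTriSets X` of the hull of its radial projection
`X = {t k / ‖t k‖}`, pulled back along the (injective) labelling to label triples `tri`: every
triple has three labels, there are twenty triples (`card_fanTriSets`, with `stub_originInterior`),
every side of a triple lies in exactly two triples (`card_filter_fanTriSets_eq_two`), every bond
is a side of exactly two triples (`stub_bondHullEdge` and
`card_filter_fanTriSets_eq_two_of_mem_hullEdges`), every bonded triangle is a triple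
(`stub_bondTriangleFacet`), and vertex links are connected in closure form (`fanTriSets_link`). -/
theorem stub_fanStruct_let (t : Fin 12 → EuclideanSpace ℝ (Fin 3)) (hinj : Function.Injective t)
    (hn : ∀ k, 1 - 1 / 50 ≤ ‖t k‖ ∧ ‖t k‖ ≤ 1 + 1 / 50)
    (hd : ∀ k l, k ≠ l → 1 - 1 / 50 ≤ dist (t k) (t l) ∧ (dist (t k) (t l) ≤ 1 + 1 / 50 ∨ 63 / 50 ≤ dist (t k) (t l)))
    (h4 : ∀ k, (Finset.univ.filter fun l => l ≠ k ∧ dist (t k) (t l) ≤ 1 + 1 / 50).card = 4) :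
    let u : Fin 12 → EuclideanSpace ℝ (Fin 3) := fun k => ‖t k‖⁻¹ • t k
    let X : Finset (EuclideanSpace ℝ (Fin 3)) := Finset.univ.image u
    let tri : Finset (Finset (Fin 12)) := Finset.univ.powerset.filter fun S => S.image u ∈ fanTriSets X
    (∀ S ∈ tri, S.card = 3) ∧ tri.card = 20 ∧
      (∀ S ∈ tri, ∀ s ⊆ S, s.card = 2 → (tri.filter fun S' => s ⊆ S').card = 2) ∧
      (∀ v w, v ≠ w → dist (t v) (t w) ≤ 1 + 1 / 50 →
        (tri.filter fun S' => ({v, w} : Finset (Fin 12)) ⊆ S').card = 2) ∧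
      (∀ a b c, a ≠ b → b ≠ c → a ≠ c → dist (t a) (t b) ≤ 1 + 1 / 50 → dist (t b) (t c) ≤ 1 + 1 / 50 →
        dist (t a) (t c) ≤ 1 + 1 / 50 → ({a, b, c} : Finset (Fin 12)) ∈ tri) ∧
      (∀ v, ∀ A ⊆ tri.filter (fun S => v ∈ S), A.Nonempty →
        (∀ S ∈ A, ∀ S' ∈ tri, v ∈ S' → (S ∩ S').card = 2 → S' ∈ A) → A = tri.filter fun S => v ∈ S) := by
  intro u X tri
  obtain ⟨hu1, hhi, hlo, hu⟩ :
      (∀ k, ‖u k‖ = 1) ∧ (∀ k l, k ≠ l → ⟪u k, u l⟫ ≤ 2801 / 5202) ∧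
        (∀ k l, dist (t k) (t l) ≤ 1 + 1 / 50 → 2201 / 4802 ≤ ⟪u k, u l⟫) ∧
        Function.Injective u :=
    shell_facts t hn hd
  have hX : X = Finset.univ.image u := rfl
  have htri : ∀ S, S ∈ tri ↔ S.image u ∈ fanTriSets X := fun S =>
    Finset.mem_filter.trans (and_iff_right (Finset.mem_powerset.2 (Finset.subset_univ S)))
  have hX1 : ∀ y ∈ X, ‖y‖ = 1 := norm_eq_one_of_mem hu1 hX
  have h0 : (0 : EuclideanSpace ℝ (Fin 3)) ∈
      interior (convexHull ℝ (X : Set (EuclideanSpace ℝ (Fin 3)))) := by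
    rw [hX, Finset.coe_image, Finset.coe_univ, Set.image_univ]
    exact stub_originInterior t hinj hn hd h4
  exact ⟨card_eq_three_of_mem_tri hu hX1 htri, card_tri hu hX1 hX htri h0,
    card_filter_side hu hX1 hX htri h0,
    fun v w hvw hb => card_filter_bond hu hX1 hX htri h0 hhi hvw (hlo v w hb),
    fun a b c hab hbc hac kab kbc kac => triple_mem_tri hu hX1 hX htri hhi hab hbc hac
      (hlo a b kab) (hlo b c kbc) (hlo a c kac),
    link_tri hu hX1 hX htri h0⟩


/-- **`stub_fanStruct`, registered form** (skeleton v6 of line `Sketch`): the abbreviations `u`, `X`, `tri`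
are explicit arguments with their defining equations (a `let` in a registered signature is cut at its
`:=` by the stub registry); immediate from the `let` form `stub_fanStruct_let` above. -/
theorem stub_fanStruct (t : Fin 12 → EuclideanSpace ℝ (Fin 3)) (hinj : Function.Injective t)
    (hn : ∀ k, 1 - 1 / 50 ≤ ‖t k‖ ∧ ‖t k‖ ≤ 1 + 1 / 50)
    (hd : ∀ k l, k ≠ l → 1 - 1 / 50 ≤ dist (t k) (t l) ∧ (dist (t k) (t l) ≤ 1 + 1 / 50 ∨ 63 / 50 ≤ dist (t k) (t l)))
    (h4 : ∀ k, (Finset.univ.filter fun l => l ≠ k ∧ dist (t k) (t l) ≤ 1 + 1 / 50).card = 4)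
    (u : Fin 12 → EuclideanSpace ℝ (Fin 3)) (hu : u = fun k => ‖t k‖⁻¹ • t k)
    (X : Finset (EuclideanSpace ℝ (Fin 3))) (hX : X = Finset.univ.image u)
    (tri : Finset (Finset (Fin 12)))
    (htri : tri = Finset.univ.powerset.filter fun S => S.image u ∈ fanTriSets X) :
    (∀ S ∈ tri, S.card = 3) ∧ tri.card = 20 ∧
      (∀ S ∈ tri, ∀ s ⊆ S, s.card = 2 → (tri.filter fun S' => s ⊆ S').card = 2) ∧
      (∀ v w, v ≠ w → dist (t v) (t w) ≤ 1 + 1 / 50 →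
        (tri.filter fun S' => ({v, w} : Finset (Fin 12)) ⊆ S').card = 2) ∧
      (∀ a b c, a ≠ b → b ≠ c → a ≠ c → dist (t a) (t b) ≤ 1 + 1 / 50 → dist (t b) (t c) ≤ 1 + 1 / 50 →
        dist (t a) (t c) ≤ 1 + 1 / 50 → ({a, b, c} : Finset (Fin 12)) ∈ tri) ∧
      (∀ v, ∀ A ⊆ tri.filter (fun S => v ∈ S), A.Nonempty →
        (∀ S ∈ A, ∀ S' ∈ tri, v ∈ S' → (S ∩ S').card = 2 → S' ∈ A) → A = tri.filter fun S => v ∈ S) := by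
  subst htri hX hu
  exact stub_fanStruct_let t hinj hn hd h4

end Summit.AtomisticToContinuum.Crystallization.Theorems
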